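import Summits.SmoothPoincare4.SmoothPoincare4.Theorems.EntropyRungConicalGapStubWeightedIntegrability
import HarnessLib

/-!
# The self-similar test function in Perelman's `μ(g, τ)` on a complete 4-d shrinker
# (line `Sketch` of crux `EntropyRung.ConicalGap`, stmt-SmoothPoincare4-16589; lead seat c2, cycle 2)

On a complete connected normalised 4-d gradient shrinking Ricci soliton `(M, g, f)` (`Ric + Hess f = g/2`,
`R + |∇f|² = f`, closed `g`-balls compact) and a scale `τ > 0`, the SELF-SIMILAR TEST FUNCTION is the
compatible shift of the rescaled potential,

  `ψ_τ = f/τ + c_τ`,  `c_τ = log h(τ)`,  `h(τ) = (16π²τ²)⁻¹ ∫ e^{-f/τ} dV`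

(`h` is the function of Wang–Wang 2023, arXiv:2308.06560, Prop. 2.6, whose monotone limit is the regularised
asymptotic volume ratio `a` of the line's skeleton, `stub_transformLimit`; `h(1) = Θ` is the Gaussian
density `(4π)⁻² ∫ e^{-f} dV`). Its `𝒲`-entropy evaluates in CLOSED FORM (`wEntropy_selfSimilar`):

  `𝒲(g, ψ_τ, τ) = ((τ − 1)²/τ) · ⟨R⟩_τ + log h(τ)`,  `⟨R⟩_τ = ∫ R e^{-f/τ} dV / ∫ e^{-f/τ} dV`,

by `|∇ψ_τ|² = τ⁻²(f − R)` and the weighted identity `∫ (f − 2τ) e^{-f/τ} = (1 − τ) ∫ R e^{-f/τ}` of the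
landed stub `stub_weightedIdentity` (p127048; the three weights are integrable by `stub_weightedIntegrability`,
p127392). Hence (`helper_muEntropy_le_selfSimilar`, registered helper of the crux item)

  `μ(g, τ) ≤ ((τ − 1)²/τ) ⟨R⟩_τ + log h(τ)`  for every `τ > 0`,

an explicit upper bound for Perelman's `μ`-entropy of a complete shrinker at ALL scales (at `τ = 1` it is
Carrillo–Ni's `μ(g, 1) ≤ log Θ`). With Li–Wang's optimal log-Sobolev constant `ν(g) = μ(g, 1) = log Θ`
(LiWang2020 Thm. 1.1, a named fact used in the sibling file `EntropyRungConicalGapConeFence.lean`) the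
left side becomes `log Θ`, and `τ → ∞` gives the CONE FENCE `Θ ≤ a · e^ρ`, `ρ = lim τ⟨R⟩_τ` (on an
asymptotically conical shrinker `ρ = (R̄_link − 6)/4`): the far end bounds the density from above.

Everything here is proved; no definition and no named fact is introduced.

## References

* Y. Wang, G. Wang, arXiv:2308.06560 (2023), Prop. 2.6 (the function `h`).
* [CarrilloNi2009] J. Carrillo, L. Ni, Comm. Anal. Geom. 17 (2009) 721–753, §4 (`μ(g,1) = log Θ`).
* [LiWang2020] Y. Li, B. Wang, Calc. Var. PDE 59 (2020), Thm. 1.1 (`ν(g) = μ(g, 1)`; context only).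
* [Perelman2002] G. Perelman, arXiv:math/0211159, §3.1 (`𝒲`, `μ`).
-/

noncomputable section

-- `Summit.SmoothPoincare4.SmoothPoincare4.…` (summit = problem) trips `dupNamespace` on every decl.
set_option linter.dupNamespace false

open scoped Manifold ContDiff ENNReal NNReal Topology
open MeasureTheory Set Filter
open Literature.Geometry.Lorentzian Literature.Geometry.Riemannian

namespace Summit.SmoothPoincare4.SmoothPoincare4.Theorems.ConicalGapSketch

/-! ## Normalising constant -/

/-- `(4πτ)^{-4/2} = (16π²τ²)⁻¹` for `τ > 0` (the 4-d Gaussian normalisation at scale `τ`). -/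
theorem selfSimilar_normalisation {τ : ℝ} (hτ : 0 < τ) :
    (4 * Real.pi * τ) ^ (-(4 : ℝ) / 2) = (16 * Real.pi ^ 2 * τ ^ 2)⁻¹ := by
  rw [show (-(4 : ℝ) / 2) = -(2 : ℝ) by norm_num, Real.rpow_neg (by positivity), Real.rpow_two]
  congr 1
  ring

/-- **The density of the self-similar test function**: with `F = ∫ e^{-f/τ} dV > 0` and
`c = log ((16π²τ²)⁻¹ F)`, the Perelman density of `ψ = τ⁻¹ f + c` at scale `τ` is `F⁻¹ e^{-f/τ}`. -/
theorem selfSimilar_entropyDensity {M : Type*} (f : M → ℝ) {τ : ℝ} (hτ : 0 < τ) {F : ℝ} (hF : 0 < F)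
    (x : M) :
    entropyDensity 4 (fun y ↦ τ⁻¹ * f y + Real.log ((16 * Real.pi ^ 2 * τ ^ 2)⁻¹ * F)) τ x =
      F⁻¹ * Real.exp (-f x / τ) := by
  have h16 : 0 < (16 * Real.pi ^ 2 * τ ^ 2)⁻¹ := by positivity
  have h16' : (16 * Real.pi ^ 2 * τ ^ 2) ≠ 0 := by positivity
  rw [entropyDensity_apply, show ((4 : ℕ) : ℝ) = 4 by norm_num, selfSimilar_normalisation hτ, neg_add,
    Real.exp_add, Real.exp_neg (Real.log _), Real.exp_log (mul_pos h16 hF),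
    show -(τ⁻¹ * f x) = -f x / τ by ring]
  field_simp

/-! ## Pointwise identities (any dimension) -/

section Pointwise

variable {n : ℕ} {M : Type*} [TopologicalSpace M] [ChartedSpace (EuclideanSpace ℝ (Fin n)) M]
  [IsManifold (𝓡 n) ∞ M]
  {g : PseudoRiemannianMetric (𝓡 n) ∞ (EuclideanSpace ℝ (Fin n)) (TangentSpace (𝓡 n) : M → Type _)}
  {f : M → ℝ}

/-- `|∇(τ⁻¹ f + c)|² = τ⁻² |∇f|²` (chain rule with the affine map `t ↦ τ⁻¹ t + c`). -/
theorem selfSimilar_gradSq (τ c : ℝ) {x : M} (hfx : MDifferentiableAt (𝓡 n) 𝓘(ℝ, ℝ) f x) :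
    g.gradSq (fun y ↦ τ⁻¹ * f y + c) x = τ⁻¹ ^ 2 * g.gradSq f x := by
  have hh : HasDerivAt (fun t : ℝ ↦ τ⁻¹ * t + c) τ⁻¹ (f x) := by
    simpa using ((hasDerivAt_id (f x)).const_mul τ⁻¹).add_const c
  have := g.gradSq_real_comp (h := fun t : ℝ ↦ τ⁻¹ * t + c) hh hfx
  rw [show (fun y ↦ τ⁻¹ * f y + c) = (fun t : ℝ ↦ τ⁻¹ * t + c) ∘ f from rfl, this]

variable [g.HasLeviCivita]

/-- **The `𝒲`-integrand of the self-similar test function, pointwise**: on a normalised shrinker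
(`R + |∇f|² = f`), for `ψ = τ⁻¹ f + c`,
`τ(R + |∇ψ|²) + ψ − n = (τ − τ⁻¹) R + 2τ⁻¹ f + (c − n)`. -/
theorem selfSimilar_integrand (hnorm : ∀ x : M, g.scalarCurvature x + g.gradSq f x = f x)
    {τ : ℝ} (hτ : τ ≠ 0) (c : ℝ) {x : M} (hfx : MDifferentiableAt (𝓡 n) 𝓘(ℝ, ℝ) f x) :
    τ * (g.scalarCurvature x + g.gradSq (fun y ↦ τ⁻¹ * f y + c) x) + (τ⁻¹ * f x + c) - n =
      (τ - τ⁻¹) * g.scalarCurvature x + 2 * τ⁻¹ * f x + (c - n) := by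
  rw [selfSimilar_gradSq τ c hfx, show g.gradSq f x = f x - g.scalarCurvature x by linarith [hnorm x]]
  field_simp
  ring

end Pointwise

/-! ## The integrated evaluation (n = 4), over `g.riemVolume` -/

section Integrated

variable {M : Type} [TopologicalSpace M] [T2Space M] [SecondCountableTopology M]
  [ChartedSpace (EuclideanSpace ℝ (Fin 4)) M] [IsManifold (𝓡 4) ∞ M] [ConnectedSpace M]
  [T3Space M] [MeasurableSpace M] [BorelSpace M]

omit [T2Space M] [SecondCountableTopology M] in
/-- **The weight `∫ e^{-f/τ} dV` is positive** on a (nonempty, connected) Riemannian manifold once it is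
integrable. -/
theorem selfSimilar_weight_pos
    (g : PseudoRiemannianMetric (𝓡 4) ∞ (EuclideanSpace ℝ (Fin 4)) (TangentSpace (𝓡 4) : M → Type _))
    (f : M → ℝ) (hg : g.IsRiemannian) (τ : ℝ)
    (hA : Integrable (fun x ↦ Real.exp (-f x / τ)) g.riemVolume) :
    0 < ∫ x, Real.exp (-f x / τ) ∂g.riemVolume := by
  haveI : Nonempty M := ConnectedSpace.toNonempty
  haveI : NeZero g.riemVolume := ⟨fun h0 ↦ by
    have hpos := PseudoRiemannianMetric.riemVolume_univ_pos (I := 𝓡 4) (M := M) hg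
    rw [h0] at hpos
    simp at hpos⟩
  exact integral_exp_pos hA

omit [T2Space M] [SecondCountableTopology M] in
/-- **Compatibility of the self-similar test function**: `∫ (4πτ)⁻² e^{-ψ} dV = 1` for
`ψ = τ⁻¹ f + log ((16π²τ²)⁻¹ ∫ e^{-f/τ} dV)`, as soon as `e^{-f/τ}` is integrable. -/
theorem selfSimilar_isEntropyCompatible
    (g : PseudoRiemannianMetric (𝓡 4) ∞ (EuclideanSpace ℝ (Fin 4)) (TangentSpace (𝓡 4) : M → Type _))
    (f : M → ℝ) (hg : g.IsRiemannian) {τ : ℝ} (hτ : 0 < τ)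
    (hA : Integrable (fun x ↦ Real.exp (-f x / τ)) g.riemVolume) :
    g.IsEntropyCompatible
      (fun y ↦ τ⁻¹ * f y + Real.log ((16 * Real.pi ^ 2 * τ ^ 2)⁻¹ * ∫ x, Real.exp (-f x / τ) ∂g.riemVolume))
      τ := by
  have hF := selfSimilar_weight_pos g f hg τ hA
  rw [PseudoRiemannianMetric.isEntropyCompatible_iff, finrank_euclideanSpace_fin]
  simp_rw [selfSimilar_entropyDensity f hτ hF]
  rw [integral_const_mul, inv_mul_cancel₀ hF.ne']

/-- **`𝒲` of the self-similar test function, closed form** (n = 4): on a complete connected normalised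
4-d gradient shrinker, for `τ > 0`, with `F = ∫ e^{-f/τ} dV` and `ψ = τ⁻¹ f + log ((16π²τ²)⁻¹ F)`,

  `𝒲(g, ψ, τ) = ((τ − 1)²/τ) · (∫ R e^{-f/τ} dV) / F + log ((16π²τ²)⁻¹ F)`.

Proof: the integrand is `[(τ − τ⁻¹) R + 2τ⁻¹ f + (c − 4)] F⁻¹ e^{-f/τ}` (`selfSimilar_integrand`), the three
weights are integrable (`weightedIntegrability_riemVolume`), and `∫ f e^{-f/τ} = 2τ F + (1 − τ) ∫ R e^{-f/τ}`
(`weightedIdentity_riemVolume`); then `(τ − τ⁻¹) + 2τ⁻¹(1 − τ) = (τ − 1)²/τ`. -/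
theorem wEntropy_selfSimilar
    (g : PseudoRiemannianMetric (𝓡 4) ∞ (EuclideanSpace ℝ (Fin 4)) (TangentSpace (𝓡 4) : M → Type _))
    [g.HasLeviCivita] (f : M → ℝ) (hg : g.IsRiemannian)
    (hc : ∀ (x : M) (r : NNReal), IsCompact {y : M | g.edist hg x y ≤ r})
    (hf : ContMDiff (𝓡 4) 𝓘(ℝ, ℝ) ∞ f)
    (hsol : ∀ (x : M) (X Y : TangentSpace (𝓡 4) x),
      g.ricci x X Y + g.hessian f x X Y = (1 / 2 : ℝ) * g.val x X Y)
    (hnorm : ∀ x : M, g.scalarCurvature x + g.gradSq f x = f x) {τ : ℝ} (hτ : 0 < τ) :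
    g.wEntropy g.leviCivita
        (fun y ↦ τ⁻¹ * f y + Real.log ((16 * Real.pi ^ 2 * τ ^ 2)⁻¹ * ∫ x, Real.exp (-f x / τ) ∂g.riemVolume))
        τ =
      (τ - 1) ^ 2 / τ * ((∫ x, g.scalarCurvature x * Real.exp (-f x / τ) ∂g.riemVolume) /
          (∫ x, Real.exp (-f x / τ) ∂g.riemVolume)) +
        Real.log ((16 * Real.pi ^ 2 * τ ^ 2)⁻¹ * ∫ x, Real.exp (-f x / τ) ∂g.riemVolume) := by
  obtain ⟨hR0, -, hprop⟩ :=
    NoncompactShrinkerGapCarrilloNiClauses.scalarCurvature_nonneg_and_isCompact_sublevel g f hg hc hf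
      hsol hnorm
  obtain ⟨hA, hB, hC⟩ := weightedIntegrability_riemVolume hg hf hsol hnorm hprop hR0 hτ
  have hWW := weightedIdentity_riemVolume g f hg hc hf hsol hnorm hτ.ne' hA hB hC
  have hF := selfSimilar_weight_pos g f hg τ hA
  set F : ℝ := ∫ x, Real.exp (-f x / τ) ∂g.riemVolume with hFdef
  set c : ℝ := Real.log ((16 * Real.pi ^ 2 * τ ^ 2)⁻¹ * F) with hcdef
  set IR : ℝ := ∫ x, g.scalarCurvature x * Real.exp (-f x / τ) ∂g.riemVolume with hIRdef
  -- `∫ f e^{-f/τ}` from the weighted identity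
  have hIf : ∫ x, f x * Real.exp (-f x / τ) ∂g.riemVolume = 2 * τ * F + (1 - τ) * IR := by
    have hsplit : ∫ x, (f x - 2 * τ) * Real.exp (-f x / τ) ∂g.riemVolume =
        (∫ x, f x * Real.exp (-f x / τ) ∂g.riemVolume) - 2 * τ * F := by
      rw [← integral_const_mul, ← integral_sub hB (hA.const_mul _)]
      refine integral_congr_ae (Eventually.of_forall fun x ↦ ?_)
      ring
    linarith [hWW, hsplit]
  -- the pointwise integrand
  have hpt : ∀ x, (τ * (g.scalarCurvatureWith g.leviCivita x + g.gradSq (fun y ↦ τ⁻¹ * f y + c) x) +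
      (τ⁻¹ * f x + c) - ((4 : ℕ) : ℝ)) * entropyDensity 4 (fun y ↦ τ⁻¹ * f y + c) τ x =
      F⁻¹ * (τ - τ⁻¹) * (g.scalarCurvature x * Real.exp (-f x / τ)) +
        F⁻¹ * (2 * τ⁻¹) * (f x * Real.exp (-f x / τ)) + F⁻¹ * (c - 4) * Real.exp (-f x / τ) := by
    intro x
    rw [PseudoRiemannianMetric.scalarCurvatureWith_leviCivita,
      selfSimilar_integrand hnorm hτ.ne' c (hf.mdifferentiableAt (by norm_num)),
      show ((4 : ℕ) : ℝ) = 4 by norm_num, hcdef, selfSimilar_entropyDensity f hτ hF]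
    ring
  rw [PseudoRiemannianMetric.wEntropy_def, finrank_euclideanSpace_fin]
  simp_rw [hpt]
  have i1 : Integrable (fun x ↦ F⁻¹ * (τ - τ⁻¹) * (g.scalarCurvature x * Real.exp (-f x / τ)))
      g.riemVolume := hC.const_mul _
  have i2 : Integrable (fun x ↦ F⁻¹ * (2 * τ⁻¹) * (f x * Real.exp (-f x / τ))) g.riemVolume :=
    hB.const_mul _
  have i3 : Integrable (fun x ↦ F⁻¹ * (c - 4) * Real.exp (-f x / τ)) g.riemVolume := hA.const_mul _
  have i12 : Integrable (fun x ↦ F⁻¹ * (τ - τ⁻¹) * (g.scalarCurvature x * Real.exp (-f x / τ)) +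
      F⁻¹ * (2 * τ⁻¹) * (f x * Real.exp (-f x / τ))) g.riemVolume := i1.add i2
  rw [integral_add i12 i3, integral_add i1 i2, integral_const_mul, integral_const_mul,
    integral_const_mul, hIf]
  rw [← hIRdef, ← hFdef]
  field_simp
  ring

/-- **`μ(g, τ)` bounded by the self-similar test function** (over `g.riemVolume`): for every `τ > 0`,
`μ(g, τ) ≤ ((τ − 1)²/τ) ⟨R⟩_τ + log ((16π²τ²)⁻¹ ∫ e^{-f/τ} dV)`. -/
theorem muEntropy_le_selfSimilar
    (g : PseudoRiemannianMetric (𝓡 4) ∞ (EuclideanSpace ℝ (Fin 4)) (TangentSpace (𝓡 4) : M → Type _))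
    [g.HasLeviCivita] (f : M → ℝ) (hg : g.IsRiemannian)
    (hc : ∀ (x : M) (r : NNReal), IsCompact {y : M | g.edist hg x y ≤ r})
    (hf : ContMDiff (𝓡 4) 𝓘(ℝ, ℝ) ∞ f)
    (hsol : ∀ (x : M) (X Y : TangentSpace (𝓡 4) x),
      g.ricci x X Y + g.hessian f x X Y = (1 / 2 : ℝ) * g.val x X Y)
    (hnorm : ∀ x : M, g.scalarCurvature x + g.gradSq f x = f x) {τ : ℝ} (hτ : 0 < τ) :
    g.muEntropy g.leviCivita τ ≤
      (((τ - 1) ^ 2 / τ * ((∫ x, g.scalarCurvature x * Real.exp (-f x / τ) ∂g.riemVolume) /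
          (∫ x, Real.exp (-f x / τ) ∂g.riemVolume)) +
        Real.log ((16 * Real.pi ^ 2 * τ ^ 2)⁻¹ * ∫ x, Real.exp (-f x / τ) ∂g.riemVolume) : ℝ) :
        EReal) := by
  obtain ⟨hR0, -, hprop⟩ :=
    NoncompactShrinkerGapCarrilloNiClauses.scalarCurvature_nonneg_and_isCompact_sublevel g f hg hc hf
      hsol hnorm
  obtain ⟨hA, -, -⟩ := weightedIntegrability_riemVolume hg hf hsol hnorm hprop hR0 hτ
  have hsmooth : ContMDiff (𝓡 4) 𝓘(ℝ, ℝ) ∞ fun y ↦ τ⁻¹ * f y +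
      Real.log ((16 * Real.pi ^ 2 * τ ^ 2)⁻¹ * ∫ x, Real.exp (-f x / τ) ∂g.riemVolume) :=
    (contMDiff_const.mul hf).add contMDiff_const
  have hle := PseudoRiemannianMetric.muEntropy_le (cov := g.leviCivita) hsmooth
    (selfSimilar_isEntropyCompatible g f hg hτ hA)
  rwa [wEntropy_selfSimilar g f hg hc hf hsol hnorm hτ] at hle

end Integrated

/-! ## The registered helper (crux vocabulary: `riemannianMeasure (g.toContMDiffRiemannianMetric hg)`) -/

/-- **Helper `helper_muEntropy_le_selfSimilar` of line `Sketch`** (crux `EntropyRung.ConicalGap`): on every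
complete connected normalised 4-d gradient shrinking Ricci soliton and for every `τ > 0`, Perelman's
`μ`-entropy is bounded by the `𝒲`-value of the self-similar test function `f/τ + log h(τ)`:

  `μ(g, τ) ≤ ((τ − 1)²/τ) · (∫ R e^{-f/τ} dV)/(∫ e^{-f/τ} dV) + log ((16π²τ²)⁻¹ ∫ e^{-f/τ} dV)`

(`dV` the Riemannian measure of `g.toContMDiffRiemannianMetric hg`, to which `g.riemVolume` unfolds by
`riemVolume_eq`). The right side tends to `log a + ρ` as `τ → ∞` on an asymptotically conical shrinker
(`a` the regularised AVR of `stub_transformLimit`, `ρ = lim τ⟨R⟩_τ`); with `ν(g) = log Θ` (LiWang2020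
Thm. 1.1) it is the cone fence `Θ ≤ a e^ρ` of the sibling file. -/
theorem helper_muEntropy_le_selfSimilar : ∀ (M : Type) [TopologicalSpace M] [T2Space M] [SecondCountableTopology M] [ChartedSpace (EuclideanSpace ℝ (Fin 4)) M] [IsManifold (𝓡 4) ∞ M] [ConnectedSpace M] [T3Space M] [MeasurableSpace M] [BorelSpace M] (g : Literature.Geometry.Lorentzian.PseudoRiemannianMetric (𝓡 4) ∞ (EuclideanSpace ℝ (Fin 4)) (TangentSpace (𝓡 4) : M → Type _)) [g.HasLeviCivita] (f : M → ℝ) (hg : g.IsRiemannian), (∀ (x : M) (r : NNReal), IsCompact {y : M | g.edist hg x y ≤ r}) → ContMDiff (𝓡 4) 𝓘(ℝ, ℝ) ∞ f → (∀ (x : M) (X Y : TangentSpace (𝓡 4) x), g.ricci x X Y + g.hessian f x X Y = (1 / 2 : ℝ) * g.val x X Y) → (∀ x : M, g.scalarCurvature x + g.gradSq f x = f x) → ∀ τ : ℝ, 0 < τ → g.muEntropy g.leviCivita τ ≤ (((τ - 1) ^ 2 / τ * ((∫ x, g.scalarCurvature x * Real.exp (-f x / τ) ∂(Literature.Geometry.Lorentzian.riemannianMeasure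 (g.toContMDiffRiemannianMetric hg))) / (∫ x, Real.exp (-f x / τ) ∂(Literature.Geometry.Lorentzian.riemannianMeasure (g.toContMDiffRiemannianMetric hg)))) + Real.log ((16 * Real.pi ^ 2 * τ ^ 2)⁻¹ * ∫ x, Real.exp (-f x / τ) ∂(Literature.Geometry.Lorentzian.riemannianMeasure (g.toContMDiffRiemannianMetric hg))) : ℝ) : EReal) := by
  intro M _ _ _ _ _ _ _ _ _ g _ f hg hc hf hsol hnorm τ hτ
  rw [← PseudoRiemannianMetric.riemVolume_eq hg]
  exact muEntropy_le_selfSimilar g f hg hc hf hsol hnorm hτ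

end Summit.SmoothPoincare4.SmoothPoincare4.Theorems.ConicalGapSketch

end
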